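import Mathlib
import HarnessLib
import Summits.HubbardSuperconductivity.HubbardSuperconductivity.Theorems.KLProgrammeKLRegimeEngineV17F2RowBOfE1Data3LBCut56
import Summits.HubbardSuperconductivity.HubbardSuperconductivity.Theorems.KLProgrammeCutCurrencyAllStrings
import Summits.HubbardSuperconductivity.HubbardSuperconductivity.Theorems.KLProgrammeKLRegimeSplitTwoLegReadingSlopesRegime
import Summits.HubbardSuperconductivity.HubbardSuperconductivity.Theorems.KLProgrammeKLRegimeEngineTowerLevAssemblyKlEngNum

/-!
# Route `KLProgramme` — ENGINE (stmt-HubbardSuperconductivity-20437 `KLRegimeEngineV17F2`), ROW (b): BINDER #6 (`hplainE1cut`) SPLIT BY TYPE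
# into the LANDED bare-vertex row and a REMAINDER binder on `𝒱ₙ − V`
(cell gate-hubbard-kl; visitor seat leafhand-hubbard-klprogramme-3 g0; helper `--supports stmt-HubbardSuperconductivity-20437` toward the registered stub
`stub_engine_step_norms` (slot (b) of ★ PIN v22, reader `A24a1G14.stub_engine_step_norms_of_E1data₃LBcut56 hE₁ ha hb hu₀ hplainE1 hincr′`))

Binder #6 of the E1-LEDGER, `hplainE1cut`, asks — under exactly `E4FlowAt`'s binders — that the `klScaleWt_n`-weighted UV-cut PLAIN quartic pinned
sums of the scale-`n` effective action `𝒱ₙ = klEffectiveAction … (klFlowFrameU …) klE0 n` obey `≤ klE0·(a·|U| + bfun·(Klam·U)²)` for every label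
string `τ′`, pinned at leg `0`.  The bare-vertex (`O(U)`) part of this row is IN THE TREE: ✓ p787853
`KLRegimeSplit.klbv_scaleWtCurrency_uvCut_hubbardInteraction_le_allStrings` bounds the same weighted cut currency of `V = hubbardInteraction L M β U`
by `(|U|/24)·(8⁴ + 2·klScale klE0 n·(8·20000·8³))`, for `128 ≤ β ≤ M`, every `n`, every `τ′`, every pinned leg.

This file turns the ledger's words «what is left of binder #6 is `𝒱ₙ − V`» into a theorem BY TYPE:
* `klbv_wtPinnedSum_norm_sectorisedKernel_le_add` — the elementary split of a weighted pinned sum of sectorised-kernel norms along `A = B + (A − B)`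
  (additivity of `sectorisedKernel` in the element, triangle inequality, nonnegative weights);
* **`hplainE1cut_of_remainder`** — binder #6 VERBATIM, with `a := (8⁴ + 2·klE0·(8·20000·8³))/(24·klE0) + a′`, from the REMAINDER binder: the same
  statement (same binders, same weight, same cut `S_ĝ`, same currency, constants `a′`, `bfun`) for the element `𝒱ₙ − V`; the thresholds give
  `128 = klBetaMin ≤ β` and `β ≤ klEngM₃ β U L ≤ M` (`beta_le_of_klEngM₃_le`), and `klScale_klE0_le_klE0` absorbs the `n`-dependence of the landed constant;
* **`stub_engine_step_norms_of_E1data₃LBcut56_remainder hE₁ ha′ hb hu₀ hrem hincr′`** ⊢ row (b) VERBATIM — the slot-(b) reader of ★ v22 with binder #6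
  replaced by its remainder (one application of the pinned reader to `hplainE1cut_of_remainder`).
Honest framing: bookkeeping; the remainder binder (the loop corrections of the quartic kernel and the counterterm insertions — everything in `𝒱ₙ`
beyond the bare quartic vertex) is an E1-class HYPOTHESIS with no supplier in the tree; nothing here asserts it, row (b), any stub of 20437, K3, U₀, the
window or superconductivity.  References: BGM 2006 §2.3 (2.23), §2.8 (2.76)–(2.84), §3 (3.2)–(3.8) [cite: BenfattoGiulianiMastropietro2006].
-/

noncomputable section

namespace Summit.HubbardSuperconductivity.HubbardSuperconductivity.Theorems.EngineV8.A24a1G14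

set_option linter.dupNamespace false -- summit = problem name (single-conjunct summit), D-0017

open Classical
open Real Finset Literature.MathematicalPhysics.QuantumLattice Literature.Probability.LatticeModels GrassmannAlgebra
open Literature.MathematicalPhysics.QuantumLattice.FermiRG
open Summit.HubbardSuperconductivity.HubbardSuperconductivity.Theorems.KLProgrammeLegKernels
open Summit.HubbardSuperconductivity.HubbardSuperconductivity.Theorems.KLRegimeSplit
open Summit.HubbardSuperconductivity.HubbardSuperconductivity.Theorems.DispersionFlow
open Summit.HubbardSuperconductivity.HubbardSuperconductivity.Theorems.EngineV8

/-! ## §1 The elementary split of a weighted pinned sum of sectorised-kernel norms -/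

/-- **Split along `A = B + (A − B)`**: for nonnegative weights `w`, a nonnegative prefactor `c`, any multiplier family `F`, any leg number `m`, any label
string `Ω` and any finite set `s` of position tuples,
`c·Σ_{x∈s} w(x)‖W_m(A)(Ω,x)‖ ≤ c·Σ_{x∈s} w(x)‖W_m(B)(Ω,x)‖ + c·Σ_{x∈s} w(x)‖W_m(A − B)(Ω,x)‖`
(additivity of `sectorisedKernel` in the element and the triangle inequality). [folklore] -/
theorem klbv_wtPinnedSum_norm_sectorisedKernel_le_add {L M N m : ℕ} [NeZero L] (β : ℝ) (F : Fin N → FreqMomentum L M → ℂ)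
    (A B : HubbardGrassmann L M) (Ω : Fin m → SectorLeg N) (s : Finset (Fin m → SpaceTimeIdx L M))
    (w : (Fin m → SpaceTimeIdx L M) → ℝ) (hw : ∀ x, 0 ≤ w x) {c : ℝ} (hc : 0 ≤ c) :
    c * ∑ x ∈ s, w x * ‖sectorisedKernel L M β F A m Ω x‖ ≤
      c * ∑ x ∈ s, w x * ‖sectorisedKernel L M β F B m Ω x‖ + c * ∑ x ∈ s, w x * ‖sectorisedKernel L M β F (A - B) m Ω x‖ := by
  rw [← mul_add, ← sum_add_distrib]
  refine mul_le_mul_of_nonneg_left (sum_le_sum fun x _ => ?_) hc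
  rw [← mul_add]
  refine mul_le_mul_of_nonneg_left ?_ (hw x)
  have hAB : A = B + (A - B) := by abel
  have hker : sectorisedKernel L M β F A m Ω x = sectorisedKernel L M β F B m Ω x + sectorisedKernel L M β F (A - B) m Ω x := by
    conv_lhs => rw [hAB]
    rw [sectorisedKernel_add]
    rfl
  rw [hker]
  exact norm_add_le _ _

/-! ## §2 Binder #6 from its remainder -/

/-- **BINDER #6 (`hplainE1cut`) FROM ITS REMAINDER, BY TYPE.**  If the `klScaleWt_n`-weighted UV-cut plain quartic pinned sums of the REMAINDER
`𝒱ₙ − V` (`𝒱ₙ = klEffectiveAction … (klFlowFrameU …) klE0 n`, `V = hubbardInteraction L M β U`) obey binder #6's bound with constants `a′`, `bfun`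
under binder #6's own hypotheses, then binder #6 holds verbatim with `a := (8⁴ + 2·klE0·(8·20000·8³))/(24·klE0) + a′` and the same `bfun`, `u₀`:
the bare-vertex part is ✓ `klbv_scaleWtCurrency_uvCut_hubbardInteraction_le_allStrings` (at `128 = klBetaMin ≤ β ≤ klEngM₃ β U L ≤ M`,
`klScale klE0 n ≤ klE0`), added to the remainder through `klbv_wtPinnedSum_norm_sectorisedKernel_le_add` and `map_sub`.
[cite: BenfattoGiulianiMastropietro2006, §2.8 (2.76)-(2.84), §3 (3.2)-(3.8)] -/
theorem hplainE1cut_of_remainder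
    {a' : ℝ} {bfun u₀ : GeoConsts → SplitConsts → RenConsts → EngConsts → ℝ → ℝ}
    (hrem : ∀ (G : GeoConsts), G.WF → ∀ (P : SplitConsts) (R : RenConsts) (Q : EngConsts) (cc : ℝ), P.WF → R.WF2 → Q.WF → 0 < cc →
      cc ≤ klEngC₃6 P R → ∀ μ ∈ klWindowC, ∀ U : ℝ, 0 < U → U ≤ u₀ G P R Q cc →
      ∀ β : ℝ, klBetaMin ≤ β → β ≤ Real.exp (cc / U ^ 2) →
      ∀ (L M : ℕ) [NeZero L] [NeZero M], klEngL₃ β U ≤ L → klEngM₃ β U L ≤ M →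
      ∀ n : ℕ, 1 ≤ n → n ≤ nScales β + 1 → IsKLRegime U cc (-(n : ℤ)) →
        HistP klPredsV17F2 L M G P Q R β U μ 0 n → FrameOK R U (nScales β) μ (klFlowFrameU L M β U μ n) →
        ∀ (τ' : Fin 4 → SectorLeg 1) (y : SpaceTimeIdx L M),
          imagTimeWeight β M ^ 3 * ∑ x' ∈ univ.filter (fun x' : Fin 4 → SpaceTimeIdx L M => x' 0 = y),
            klScaleWt L M β n ((univ.image x').image (fun x : SpaceTimeIdx L M => (((((2 * (x.1 : ℕ) : ℕ)) : ZMod (2 * (2 * M)))), x.2))) *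
              ‖sectorisedKernel L M β (trivialMultiplier L M)
                (ExteriorAlgebra.map (LinearMap.mulLeft ℂ (fun K : HubbardFieldIdx L M => ((gnScaleCutoff 4 klE0 1 |matsubaraFreq β M K.1.1.1| : ℝ) : ℂ)))
                  (klEffectiveAction L M β U μ (klFlowFrameU L M β U μ n) klE0 n - hubbardInteraction L M β U)) 4 τ' x'‖ ≤
          klE0 * (a' * |U| + bfun G P R Q cc * (P.Klam * U) ^ 2)) :
    ∀ (G : GeoConsts), G.WF → ∀ (P : SplitConsts) (R : RenConsts) (Q : EngConsts) (cc : ℝ), P.WF → R.WF2 → Q.WF → 0 < cc →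
      cc ≤ klEngC₃6 P R → ∀ μ ∈ klWindowC, ∀ U : ℝ, 0 < U → U ≤ u₀ G P R Q cc →
      ∀ β : ℝ, klBetaMin ≤ β → β ≤ Real.exp (cc / U ^ 2) →
      ∀ (L M : ℕ) [NeZero L] [NeZero M], klEngL₃ β U ≤ L → klEngM₃ β U L ≤ M →
      ∀ n : ℕ, 1 ≤ n → n ≤ nScales β + 1 → IsKLRegime U cc (-(n : ℤ)) →
        HistP klPredsV17F2 L M G P Q R β U μ 0 n → FrameOK R U (nScales β) μ (klFlowFrameU L M β U μ n) →
        ∀ (τ' : Fin 4 → SectorLeg 1) (y : SpaceTimeIdx L M),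
          imagTimeWeight β M ^ 3 * ∑ x' ∈ univ.filter (fun x' : Fin 4 → SpaceTimeIdx L M => x' 0 = y),
            klScaleWt L M β n ((univ.image x').image (fun x : SpaceTimeIdx L M => (((((2 * (x.1 : ℕ) : ℕ)) : ZMod (2 * (2 * M)))), x.2))) *
              ‖sectorisedKernel L M β (trivialMultiplier L M)
                (ExteriorAlgebra.map (LinearMap.mulLeft ℂ (fun K : HubbardFieldIdx L M => ((gnScaleCutoff 4 klE0 1 |matsubaraFreq β M K.1.1.1| : ℝ) : ℂ)))
                  (klEffectiveAction L M β U μ (klFlowFrameU L M β U μ n) klE0 n)) 4 τ' x'‖ ≤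
          klE0 * (((8 ^ 4 + 2 * klE0 * (8 * 20000 * 8 ^ 3)) / (24 * klE0) + a') * |U| + bfun G P R Q cc * (P.Klam * U) ^ 2) := by
  intro G hG P R Q cc hP hR hQ hcc hcc6 μ hμ U hU hUu β hβ hβc L M _ _ hL hM n hn1 hn hreg hhist hfr τ' y
  have h128 : (128 : ℝ) ≤ β := le_trans (by norm_num [klBetaMin]) hβ
  have hβ0 : (0 : ℝ) ≤ β := le_trans (by norm_num) h128
  have hβM : β ≤ (M : ℝ) := beta_le_of_klEngM₃_le hM
  have hE : (0 : ℝ) < klE0 := by norm_num [klE0]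
  -- the landed bare-vertex row (all strings), pinned at leg `0`
  have hbare := klbv_scaleWtCurrency_uvCut_hubbardInteraction_le_allStrings (L := L) (M := M) h128 hβM n U τ' 0 y
  -- the remainder row
  have hremv := hrem G hG P R Q cc hP hR hQ hcc hcc6 μ hμ U hU hUu β hβ hβc L M hL hM n hn1 hn hreg hhist hfr τ' y
  -- the split
  have hsplit := klbv_wtPinnedSum_norm_sectorisedKernel_le_add (m := 4) β (trivialMultiplier L M)
    (ExteriorAlgebra.map (LinearMap.mulLeft ℂ (fun K : HubbardFieldIdx L M => ((gnScaleCutoff 4 klE0 1 |matsubaraFreq β M K.1.1.1| : ℝ) : ℂ)))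
      (klEffectiveAction L M β U μ (klFlowFrameU L M β U μ n) klE0 n))
    (ExteriorAlgebra.map (LinearMap.mulLeft ℂ (fun K : HubbardFieldIdx L M => ((gnScaleCutoff 4 klE0 1 |matsubaraFreq β M K.1.1.1| : ℝ) : ℂ)))
      (hubbardInteraction L M β U))
    τ' (univ.filter (fun x' : Fin 4 → SpaceTimeIdx L M => x' 0 = y))
    (fun x' => klScaleWt L M β n ((univ.image x').image (fun x : SpaceTimeIdx L M => (((((2 * (x.1 : ℕ) : ℕ)) : ZMod (2 * (2 * M)))), x.2))))
    (fun x' => le_trans zero_le_one (one_le_klScaleWt L M β n _)) (pow_nonneg (imagTimeWeight_nonneg hβ0 M) 3)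
  rw [← map_sub] at hsplit
  -- the bare constant, made `n`-free
  have hΛ : klScale klE0 n ≤ klE0 := klScale_klE0_le_klE0 n
  have hbare' : |U| / 24 * (8 ^ 4 + 2 * klScale klE0 n * (8 * 20000 * 8 ^ 3)) ≤
      klE0 * ((8 ^ 4 + 2 * klE0 * (8 * 20000 * 8 ^ 3)) / (24 * klE0) * |U|) := by
    have hrw : klE0 * ((8 ^ 4 + 2 * klE0 * (8 * 20000 * 8 ^ 3)) / (24 * klE0) * |U|) = |U| / 24 * (8 ^ 4 + 2 * klE0 * (8 * 20000 * 8 ^ 3)) := by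
      field_simp
    rw [hrw]
    have hU0 : 0 ≤ |U| / 24 := by positivity
    gcongr
  calc _ ≤ _ := hsplit
    _ ≤ klE0 * ((8 ^ 4 + 2 * klE0 * (8 * 20000 * 8 ^ 3)) / (24 * klE0) * |U|) + klE0 * (a' * |U| + bfun G P R Q cc * (P.Klam * U) ^ 2) :=
        add_le_add (hbare.trans hbare') hremv
    _ = _ := by ring

/-- Nonnegativity of the split constant: `0 ≤ (8⁴ + 2·klE0·(8·20000·8³))/(24·klE0) + a′` for `0 ≤ a′`. [folklore] -/
theorem plainSplit_const_nonneg {a' : ℝ} (ha' : 0 ≤ a') : 0 ≤ (8 ^ 4 + 2 * klE0 * (8 * 20000 * 8 ^ 3)) / (24 * klE0) + a' := by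
  have hE : (0 : ℝ) < klE0 := by norm_num [klE0]
  positivity

/-! ## §3 The slot-(b) reader with binder #6 replaced by its remainder -/

/-- **ROW (b) FROM E1-CLASS DATA, BINDER #6 REPLACED BY ITS REMAINDER** — the ★ v22 slot-(b) reader `stub_engine_step_norms_of_E1data₃LBcut56` with
`hplainE1cut` supplied by `hplainE1cut_of_remainder`: hypotheses `hE₁` (E1's (E2)∧(E4)∧(E6) family, UV-cut (E4)), numeric `a′ ≥ 0`, `bfun ≥ 0`,
`u₀ > 0`, **`hrem`** (binder #6's statement for the remainder `𝒱ₙ − V`), `hincr′` (weighted two-leg slice increments) ⊢ row (b) VERBATIM.  Every binder is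
a HYPOTHESIS; nothing is asserted. [cite: BenfattoGiulianiMastropietro2006, §2.5-§2.8 (2.52)-(2.84), Lemma 2.5 (2.98), §3 (3.2)-(3.8)] -/
theorem stub_engine_step_norms_of_E1data₃LBcut56_remainder
    (hE₁ : ∀ (P : SplitConsts) (R : RenConsts), P.WF → R.WF2 →
      ∃ s₂u s₂c s₄ S₆ : ℝ, 0 ≤ s₂u ∧ 0 ≤ s₂c ∧ 0 ≤ s₄ ∧ 0 ≤ S₆ ∧ ∃ cE UE : ℝ, 0 < cE ∧ 0 < UE ∧
      ∀ (Q : EngConsts) (cc : ℝ), 0 < cc → cc ≤ klEngC₃6 P R → cc ≤ cE →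
      ∀ μ ∈ klWindowC, ∀ U : ℝ, 0 < U → U ≤ klEngU₀10 P R cc → U ≤ UE →
      ∀ β : ℝ, klBetaMin ≤ β → β ≤ Real.exp (cc / U ^ 2) →
      ∀ (L M : ℕ) [NeZero L] [NeZero M], klEngL₄ P R β U ≤ L → klEngM₃ β U L ≤ M →
      ∀ n : ℕ, 1 ≤ n → n ≤ nScales β + 1 → IsKLRegime U cc (-(n : ℤ)) →
      HistP klPredsV17F2 L M klEngGeo14 P Q R β U μ 0 n →
      (∀ m, 1 ≤ m → m < n → FlowPieceOscAt L M (klReadOscC P R) β U μ m) →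
      FrameOK R U (nScales β) μ (klFlowFrameU L M β U μ n) →
      (∀ j ≤ n, LevelsUExportMixedAt L M (klCU2 P R (klEngQ7 P R)) P β U μ j) →
      (∀ i, 1 ≤ i → i ≤ n → ∀ (q : Fin 2) (w : SpaceTimeIdx L M × SectorLeg (sectorCount (i - 1))),
        klWtPinnedSumOf L M β μ (klFlowFrameU L M β U μ n) (i - 1) 2 (klEffectiveAction L M β U μ (klFlowFrameU L M β U μ n) klE0 i) q w ≤
          (s₂u * |U| + s₂c * cc) * ((4 : ℝ) ^ (i - 1))⁻¹) ∧
      (∀ i, 1 ≤ i → i ≤ n → ∀ (q : Fin 4) (τ' : Fin 4 → SectorLeg 1) (y' : SpaceTimeIdx L M),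
        imagTimeWeight β M ^ 3 * ∑ x' ∈ univ.filter (fun x' : Fin 4 → SpaceTimeIdx L M => x' q = y'),
          klScaleWt L M β i ((univ.image x').image (fun x : SpaceTimeIdx L M => (((((2 * (x.1 : ℕ) : ℕ)) : ZMod (2 * (2 * M)))), x.2))) *
            ‖sectorisedKernel L M β (trivialMultiplier L M)
              (ExteriorAlgebra.map (LinearMap.mulLeft ℂ (fun K : HubbardFieldIdx L M => ((gnScaleCutoff 4 klE0 1 |matsubaraFreq β M K.1.1.1| : ℝ) : ℂ))) (klEffectiveAction L M β U μ (klFlowFrameU L M β U μ n) klE0 i)) 4 τ' x'‖ ≤ s₄ * epsCoupling P U i) ∧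
      (∀ i, 1 ≤ i → i ≤ n → ∀ (q : Fin 6) (w : SpaceTimeIdx L M × SectorLeg (sectorCount (i - 1))),
        klWtPinnedSumOf L M β μ (klFlowFrameU L M β U μ n) (i - 1) 6 (klEffectiveAction L M β U μ (klFlowFrameU L M β U μ n) klE0 i) q w ≤
          S₆ * epsCoupling P U i ^ 2 * (2 : ℝ) ^ (4 * i)))
    {a' : ℝ} (ha' : 0 ≤ a') {bfun u₀ : GeoConsts → SplitConsts → RenConsts → EngConsts → ℝ → ℝ}
    (hb : ∀ G P R Q cc, 0 ≤ bfun G P R Q cc) (hu₀ : ∀ G P R Q cc, 0 < u₀ G P R Q cc)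
    (hrem : ∀ (G : GeoConsts), G.WF → ∀ (P : SplitConsts) (R : RenConsts) (Q : EngConsts) (cc : ℝ), P.WF → R.WF2 → Q.WF → 0 < cc →
      cc ≤ klEngC₃6 P R → ∀ μ ∈ klWindowC, ∀ U : ℝ, 0 < U → U ≤ u₀ G P R Q cc →
      ∀ β : ℝ, klBetaMin ≤ β → β ≤ Real.exp (cc / U ^ 2) →
      ∀ (L M : ℕ) [NeZero L] [NeZero M], klEngL₃ β U ≤ L → klEngM₃ β U L ≤ M →
      ∀ n : ℕ, 1 ≤ n → n ≤ nScales β + 1 → IsKLRegime U cc (-(n : ℤ)) →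
        HistP klPredsV17F2 L M G P Q R β U μ 0 n → FrameOK R U (nScales β) μ (klFlowFrameU L M β U μ n) →
        ∀ (τ' : Fin 4 → SectorLeg 1) (y : SpaceTimeIdx L M),
          imagTimeWeight β M ^ 3 * ∑ x' ∈ univ.filter (fun x' : Fin 4 → SpaceTimeIdx L M => x' 0 = y),
            klScaleWt L M β n ((univ.image x').image (fun x : SpaceTimeIdx L M => (((((2 * (x.1 : ℕ) : ℕ)) : ZMod (2 * (2 * M)))), x.2))) *
              ‖sectorisedKernel L M β (trivialMultiplier L M)
                (ExteriorAlgebra.map (LinearMap.mulLeft ℂ (fun K : HubbardFieldIdx L M => ((gnScaleCutoff 4 klE0 1 |matsubaraFreq β M K.1.1.1| : ℝ) : ℂ)))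
                  (klEffectiveAction L M β U μ (klFlowFrameU L M β U μ n) klE0 n - hubbardInteraction L M β U)) 4 τ' x'‖ ≤
          klE0 * (a' * |U| + bfun G P R Q cc * (P.Klam * U) ^ 2))
    (hincr : ∀ (P : SplitConsts) (R : RenConsts), P.WF → R.WF2 →
      ∃ Bw : ℝ, 0 ≤ Bw ∧ ∃ uI : EngConsts → ℝ → ℝ, (∀ Q cc, 0 < uI Q cc) ∧ ∃ cI : ℝ, 0 < cI ∧
      ∀ Q : EngConsts, (klEngQ7 P R).IsRaiseOf Q →
      ∀ cc : ℝ, 0 < cc → cc ≤ klEngC₃6 P R → cc ≤ cI →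
      ∀ μ ∈ klWindowC, ∀ U : ℝ, 0 < U → U ≤ klEngU₀10 P R cc → U ≤ uI Q cc →
      ∀ β : ℝ, klBetaMin ≤ β → β ≤ Real.exp (cc / U ^ 2) →
      ∀ (L M : ℕ) [NeZero L] [NeZero M], klEngL₄ P R β U ≤ L → klEngM₃ β U L ≤ M →
      ∀ n : ℕ, 1 ≤ n → n ≤ nScales β + 1 →
        HistP klPredsV17F2 L M klEngGeo14 P Q R β U μ 0 n → FrameOK R U (nScales β) μ (klFlowFrameU L M β U μ n) →
        ∃ b : ℕ → ℝ, (∑ j ∈ range n, (klScale klE0 (j + 1))⁻¹ * b j ≤ Bw) ∧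
          ∀ j < n, ∀ w : GridLeg (GridPoint L (2 * (2 * M))),
            ∑ Y ∈ univ.filter (fun Y : Fin 2 → GridLeg (GridPoint L (2 * (2 * M))) => Y 0 = w),
              (klScaleWt L M β (j + 1) ((univ.image Y).image gridLegPos) - 1) *
                ‖kernel ℂ
                  (effAction ℂ ((hubbardGridSub L M β (2 * (2 * M))).transpose *
                      hubbardCovAboveCT L M β μ 0 (klFlowFrameU L M β U μ n) (klScale klE0 (j + 1)) * hubbardGridSub L M β (2 * (2 * M)))
                    (hubbardGridInteraction L (2 * (2 * M)) β U + hubbardGridCounterQuadratic L (2 * (2 * M)) β (klFlowFrameU L M β U μ n)) -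
                  effAction ℂ ((hubbardGridSub L M β (2 * (2 * M))).transpose *
                      hubbardCovAboveCT L M β μ 0 (klFlowFrameU L M β U μ n) (klScale klE0 j) * hubbardGridSub L M β (2 * (2 * M)))
                    (hubbardGridInteraction L (2 * (2 * M)) β U + hubbardGridCounterQuadratic L (2 * (2 * M)) β (klFlowFrameU L M β U μ n))) 2 Y‖ ≤
              b j * U ^ 2 * (β / (2 * ((2 * (2 * M) : ℕ) : ℝ)))) :
    ∀ (P : SplitConsts) (R : RenConsts) (c : ℝ), P.WF → R.WF2 → 0 < c → c ≤ klEngC₃7GU klEngGeo14 P R →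
      ∀ μ ∈ klWindowC, ∀ U : ℝ, 0 < U → U ≤ klEngU₀12GQ klEngGeo14 (klEngQ9dG klEngGeo14 P R) P R c → ∀ β : ℝ, klBetaMin ≤ β → β ≤ Real.exp (c / U ^ 2) →
        ∀ (L M : ℕ) [NeZero L] [NeZero M], klEngL₄ P R β U ≤ L → klEngM₃ β U L ≤ M →
          ∀ n : ℕ, 1 ≤ n → n ≤ nScales β + 1 → IsKLRegime U c (-(n : ℤ)) →
            HistP klPredsV17F2 L M klEngGeo14 P (klEngQ9dG klEngGeo14 P R) R β U μ 0 n →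
              (∀ m, 1 ≤ m → m < n → FlowPieceOscAt L M (klReadOscC P R) β U μ m) →
              FrameOK R U (nScales β) μ (klFlowFrameU L M β U μ n) →
                (∀ j ≤ n, LevelsUExportMixedAt L M (klCU2 P R (klEngQ7 P R)) P β U μ j) →
                  KernelNormsV4 L M P (klEngQ9dG klEngGeo14 P R) β U μ (klFlowFrameU L M β U μ n) n ∧
                    (∀ j ≤ n, (KernelNormsLevels L M P (klEngQ9dG klEngGeo14 P R) β U μ (klFlowFrameU L M β U μ n) j ∧
                      KernelNormsWt4 L M (klWtBudget P (klEngQ9dG klEngGeo14 P R) U j) β U μ (klFlowFrameU L M β U μ n) j)) ∧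
                    EngineFirstMoments L M klEngGeo14 P (klEngQ9dG klEngGeo14 P R) β U μ (klFlowFrameU L M β U μ n) n ∧
                    IsoFirstMomentsAt L M klIsoMomC (klIsoMomD P R) P β U μ n ∧
                    TwoLegGridFlowMomentsAtC L M (klZtG klEngGeo14 P R) (klZs1G klEngGeo14 P R) (klZs2G klEngGeo14 P R) c β U μ n :=
  stub_engine_step_norms_of_E1data₃LBcut56 hE₁ (plainSplit_const_nonneg ha') hb hu₀ (hplainE1cut_of_remainder hrem) hincr

end Summit.HubbardSuperconductivity.HubbardSuperconductivity.Theorems.EngineV8.A24a1G14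

end
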